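import Literature.Computability.AlgebraicComplexity.LMR13PLambdaStabilizerThree
import HarnessLib

/-!
# `dim 𝔤𝔩(W)·P` and `dim 𝔤𝔩(W)_P` are invariant under an invertible linear change of variables

Theorem-only companion of `GLAnnihilator.lean` / `LMR13PLambdaStabilizerThree.lean` (cell `val-lit`,
seat p8 g4; the infrastructure lemma (L1)/(δ) of the lead's BLUEPRINT-X3b for the stabiliser counts of
Landsberg–Manivel–Ressayre 2013 §3.5). For a form `P ∈ ℂ[x_σ]` and an invertible matrix `A`, the
linear substitution `linSubst σ ℂ A` (`x_i ↦ Σ_j A_{ji} x_j`, `LinSubst.lean`) carries the orbit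
tangent space `𝔤𝔩(W)·P = span {x_b ∂_a P}` (`glTangent`) onto `𝔤𝔩(W)·(A·P)`, so

* `finrank_glTangent_linSubst_eq` — `dim 𝔤𝔩(W)·(A·P) = dim 𝔤𝔩(W)·P`;
* `finrank_glAnn_linSubst_eq` — `dim 𝔤𝔩(W)_{A·P} = dim 𝔤𝔩(W)_P` (the annihilator `glAnn`, via
  `finrank_glTangent_add_finrank_glAnn`); `finrank_glAnn_C_mul` — rescaling by `c ≠ 0` changes nothing.

This is the (elementary) fact behind "the Lie algebra of the stabilizer of `[P_Λ]`" being an invariant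
of the `GL(W)`-orbit (LMR 2013 §3.5, p. 481, arXiv:1004.4802 `p0008.txt:L92`): the stabiliser of
`A·P` is the conjugate `A H_P A⁻¹`. The proof here is the chain rule (`glTangent_aeval_le_map` of
`LMR13PLambdaStabilizerThree.lean`) applied to `A` and to `A⁻¹`. No definitions, no named facts.
Honest framing: linear algebra; **VP ≠ VNP is NOT proved and nothing here is progress on it.**

## References

* [LandsbergManivelRessayre2013] Comment. Math. Helv. 88 (2013), §3.5 (p. 481); arXiv:1004.4802.
* [Landsberg2017] J. M. Landsberg, *Geometry and Complexity Theory*, CUP 2017, §1.2 (linear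
  substitutions), §8.5.1 (stabilisers of orbits).
-/

noncomputable section

open MvPolynomial Matrix

namespace Literature.Computability.AlgebraicComplexity

variable {σ : Type*} [Fintype σ] [DecidableEq σ]

/-- **`𝔤𝔩(W)·(A·P) ⊆ A·(𝔤𝔩(W)·P)`** for an invertible linear substitution `A` (chain rule).
[cite: LandsbergManivelRessayre2013, §3.5 (p. 481)] -/
theorem glTangent_linSubst_le_map (A : Matrix σ σ ℂ) (hA : IsUnit A.det) (P : MvPolynomial σ ℂ) :
    glTangent (linSubst σ ℂ A P) ≤ (glTangent P).map (linSubst σ ℂ A).toLinearMap := by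
  have hL : ∀ c a : σ, ∃ r : ℂ,
      pderiv a ((fun i : σ => ∑ j, A j i • (X j : MvPolynomial σ ℂ)) c) = C r := by
    intro c a
    refine ⟨A a c, ?_⟩
    simp only [map_sum, Derivation.map_smul, pderiv_X]
    rw [Finset.sum_eq_single a]
    · rw [Pi.single_eq_same, smul_eq_C_mul, mul_one]
    · intro j _ hj
      rw [Pi.single_eq_of_ne' hj.symm, smul_zero]
    · intro ha; exact absurd (Finset.mem_univ a) ha
  have hinv : ∀ b : σ, ∃ ℓ : MvPolynomial σ ℂ,
      ℓ ∈ Submodule.span ℂ (Set.range (X : σ → MvPolynomial σ ℂ)) ∧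
        aeval (fun i : σ => ∑ j, A j i • (X j : MvPolynomial σ ℂ)) ℓ = X b := by
    intro b
    refine ⟨linSubst σ ℂ A⁻¹ (X b), ?_, ?_⟩
    · rw [linSubst_X]
      exact Submodule.sum_mem _ fun j _ => Submodule.smul_mem _ _ (Submodule.subset_span ⟨j, rfl⟩)
    · change linSubst σ ℂ A (linSubst σ ℂ A⁻¹ (X b)) = X b
      rw [← AlgHom.comp_apply, ← linSubst_mul, Matrix.mul_nonsing_inv A hA, linSubst_one,
        AlgHom.id_apply]
  exact glTangent_aeval_le_map _ hL hinv P

/-- `dim 𝔤𝔩(W)·(A·P) ≤ dim 𝔤𝔩(W)·P` for invertible `A`. [cite: LandsbergManivelRessayre2013, §3.5 (p. 481)] -/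
theorem finrank_glTangent_linSubst_le (A : Matrix σ σ ℂ) (hA : IsUnit A.det) (P : MvPolynomial σ ℂ) :
    Module.finrank ℂ (glTangent (linSubst σ ℂ A P)) ≤ Module.finrank ℂ (glTangent P) := by
  haveI := glTangent_finiteDimensional P
  exact (Submodule.finrank_mono (glTangent_linSubst_le_map A hA P)).trans (Submodule.finrank_map_le _ _)

/-- **`dim 𝔤𝔩(W)·(A·P) = dim 𝔤𝔩(W)·P`** for invertible `A` (apply the inequality to `A` and `A⁻¹`).
[cite: LandsbergManivelRessayre2013, §3.5 (p. 481)] -/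
theorem finrank_glTangent_linSubst_eq (A : Matrix σ σ ℂ) (hA : IsUnit A.det) (P : MvPolynomial σ ℂ) :
    Module.finrank ℂ (glTangent (linSubst σ ℂ A P)) = Module.finrank ℂ (glTangent P) := by
  refine le_antisymm (finrank_glTangent_linSubst_le A hA P) ?_
  have h := finrank_glTangent_linSubst_le A⁻¹ (A.isUnit_nonsing_inv_det hA) (linSubst σ ℂ A P)
  rwa [← AlgHom.comp_apply, ← linSubst_mul, Matrix.nonsing_inv_mul A hA, linSubst_one,
    AlgHom.id_apply] at h

/-- **`dim 𝔤𝔩(W)_{A·P} = dim 𝔤𝔩(W)_P`** for invertible `A`: the dimension of the annihilator (the Lie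
algebra of the stabiliser) is an invariant of the `GL(W)`-orbit — the form in which LMR 2013 §3.5
compare "the stabilizer of `[P_Λ]`" and "the stabilizer of `[det_n]`".
[cite: LandsbergManivelRessayre2013, §3.5 (p. 481)] -/
theorem finrank_glAnn_linSubst_eq (A : Matrix σ σ ℂ) (hA : IsUnit A.det) (P : MvPolynomial σ ℂ) :
    Module.finrank ℂ (glAnn (linSubst σ ℂ A P)) = Module.finrank ℂ (glAnn P) := by
  have h1 := finrank_glTangent_add_finrank_glAnn (linSubst σ ℂ A P)
  have h2 := finrank_glTangent_add_finrank_glAnn P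
  rw [finrank_glTangent_linSubst_eq A hA P] at h1
  omega

omit [DecidableEq σ] in
/-- `dim 𝔤𝔩(W)_{c·P} = dim 𝔤𝔩(W)_P` for `c ≠ 0` (the counts concern the projective point `[P]`).
[cite: LandsbergManivelRessayre2013, §3.5 (p. 481)] -/
theorem finrank_glAnn_C_mul {c : ℂ} (hc : c ≠ 0) (P : MvPolynomial σ ℂ) :
    Module.finrank ℂ (glAnn (C c * P)) = Module.finrank ℂ (glAnn P) := by
  have h1 := finrank_glTangent_add_finrank_glAnn (C c * P)
  have h2 := finrank_glTangent_add_finrank_glAnn P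
  rw [glTangent_C_mul hc] at h1
  omega

/-- The `GL(W)`-action by units: `dim 𝔤𝔩(W)_{g·P} = dim 𝔤𝔩(W)_P` for `g : GL σ ℂ` (`linSubstRep`).
[cite: LandsbergManivelRessayre2013, §3.5 (p. 481)] -/
theorem finrank_glAnn_linSubstRep_eq (g : GL σ ℂ) (P : MvPolynomial σ ℂ) :
    Module.finrank ℂ (glAnn (linSubstRep σ ℂ g P)) = Module.finrank ℂ (glAnn P) := by
  rw [linSubstRep_apply]
  exact finrank_glAnn_linSubst_eq (g : Matrix σ σ ℂ) (Matrix.isUnits_det_units g) P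

end Literature.Computability.AlgebraicComplexity
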